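import Summits.QuantumFields.YangMills.Theorems.VirialFluxGapCentralProjectionDefs
import Summits.QuantumFields.YangMills.Theorems.VirialFluxGapCentralZeroModeCoord
import HarnessLib

/-!
# Route `VirialFluxGap` (YangMills): the central projection `π_C` IS A PROJECTION onto the central family, the central energy scale
# `F₀∘π_C ≤ 36L²r⁴`, and (E1) AT THE PROJECTED POINT for every history of the chart

Brick (C1-e) of the central charts for ⟨stmt-QuantumFields-24141⟩ (LEAD design note №4; host `X_fix`), continuing ✓`VirialFluxGapCentralProjectionDefs`:

* ★ `blockIm_centralProj` ∕ `seamIm_centralProj` — `z ∘ π_C = z` (the projected history has the same block averages), hence ★ `centralProj_idem` —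
  `π_C ∘ π_C = π_C`; with ✓`centralProj_combConst` this makes `π_C` a retraction of the chart onto the comb-constant family `C`;
* `centralRep_hemisphere` — the representatives of `π_C P` lie on the hemispheres of their signs with radial factor `≥ 1 − |z_B|²`;
* ★ `ringDeficit_centralProj_le` — the CENTRAL ENERGY SCALE: if every block average has `|z_B|² ≤ ρ` then `F₀(π_C P) ≤ 36·L²·ρ²` (the handover
  `√λ⋆ ≪ r₀ ≪ L⁻²` of note №4 (d) compares this with the transverse quadratic energy);
* ★★★ `cone_euler_centralProj` — (E1) AT `π_C P` FOR EVERY `P`: `2(1 − ρ)·F₀(π_C P) ≤ ∂_{Y_z} F₀ (π_C P)` with `Y_z = dirOf fixFrame (u_z(π_C P))`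
  the zero-mode direction (✓`cone_euler_fixFrame`), hypotheses ONLY on the block averages of `P` (`|z_B|² ≤ ρ`) and the signs `σ ∈ {±1}⁴`.

HONEST FRAMING: the zero-mode half at the projected point; the transverse half, (E2) and the patching are NOT here; ⟨24141⟩ stays OPEN; the
Yang–Mills mass gap is NOT proved; no summit is proved by a line.  THEOREMS ONLY (0 `def`, 0 `sorry`), standard axioms.  Width seat
`ym-line-sfw-p2-w3` g58 (cell ym-idea-1, free hands), `--supports stmt-QuantumFields-24141`.  References: [cite: CosteEtAl1985]; [cite: Luscher1983, §2].
-/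

set_option autoImplicit false

noncomputable section

open scoped Matrix Quaternion BigOperators
open Literature.MathematicalPhysics.QuantumFieldTheory hiding SU2
open Literature.MathematicalPhysics.QuantumLattice

namespace Summit.QuantumFields.YangMills.Theorems.VirialFluxGap.FrameDerivative

open Summit.QuantumFields.YangMills.Theorems.FemtoTransferGap
open Summit.QuantumFields.YangMills.Theorems.FemtoTransferGap.TwoLattice.Flat (combFlat combFlat_apply)
open Summit.QuantumFields.YangMills.Theorems.VirialFluxGap.RingDeficit
open Summit.QuantumFields.YangMills.Theorems.VirialFluxGap.FrameHessian
open Summit.QuantumFields.YangMills.Theorems.VirialFluxGap.FixFrame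

variable {L : ℕ} [NeZero L]

/-! ## §1 `z ∘ π_C = z` and idempotence -/

omit [NeZero L] in
/-- Signs `σ = ±1` have `σ² = 1`. [folklore] -/
theorem sq_eq_one_of_sign {σ : ℝ} (hσ : σ = 1 ∨ σ = -1) : σ ^ 2 = 1 := by
  rcases hσ with h | h <;> simp [h]

omit [NeZero L] in
/-- The imaginary parts of the central representative are the block data (`|z| ≤ 1`, `σ = ±1`). [folklore] -/
theorem im_centralRep {σ : ℝ} (hσ : σ ^ 2 = 1) {z : Fin 3 → ℝ} (hz : (z 0) ^ 2 + (z 1) ^ 2 + (z 2) ^ 2 ≤ 1) :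
    (![(su2Quat (centralRep σ z)).imI, (su2Quat (centralRep σ z)).imJ, (su2Quat (centralRep σ z)).imK] : Fin 3 → ℝ) = z := by
  rw [su2Quat_centralRep hσ hz]
  funext a
  fin_cases a <;> rfl

/-- ★ **`π_C` preserves the wrap-block averages**: `blockIm (wrapBlock k) k (π_C P) = blockIm (wrapBlock k) k P`. [cite: CosteEtAl1985] -/
theorem blockIm_centralProj {σ : Fin 3 → ℝ} (hσ : ∀ k, σ k = 1 ∨ σ k = -1) (σ₄ : ℝ) (k : Fin 3)
    (P : (Fin (2 * L - 1 + 1) → GaugeConfig 3 L SU2) × (Site 3 L → SU2)) :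
    blockIm L (wrapBlock L k) k (centralProj L σ σ₄ P) = blockIm L (wrapBlock L k) k P := by
  rw [centralProj, blockIm_wrapBlock_combConst]
  exact im_centralRep (sq_eq_one_of_sign (hσ k)) (normSq_blockIm_le_one _ k P)

/-- ★ **`π_C` preserves the seam average**: `seamIm (π_C P) = seamIm P`. [cite: CosteEtAl1985] -/
theorem seamIm_centralProj (σ : Fin 3 → ℝ) {σ₄ : ℝ} (hσ₄ : σ₄ = 1 ∨ σ₄ = -1)
    (P : (Fin (2 * L - 1 + 1) → GaugeConfig 3 L SU2) × (Site 3 L → SU2)) :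
    seamIm L (centralProj L σ σ₄ P) = seamIm L P := by
  rw [centralProj, seamIm_of_const_seam]
  exact im_centralRep (sq_eq_one_of_sign hσ₄) (normSq_seamIm_le_one P)

/-- ★ **`π_C` is idempotent**: `π_C (π_C P) = π_C P`. [cite: CosteEtAl1985] -/
theorem centralProj_idem {σ : Fin 3 → ℝ} {σ₄ : ℝ} (hσ : ∀ k, σ k = 1 ∨ σ k = -1) (hσ₄ : σ₄ = 1 ∨ σ₄ = -1)
    (P : (Fin (2 * L - 1 + 1) → GaugeConfig 3 L SU2) × (Site 3 L → SU2)) :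
    centralProj L σ σ₄ (centralProj L σ σ₄ P) = centralProj L σ σ₄ P := by
  have hb : ∀ k, blockIm L (wrapBlock L k) k (centralProj L σ σ₄ P) = blockIm L (wrapBlock L k) k P :=
    fun k => blockIm_centralProj hσ σ₄ k P
  have hs := seamIm_centralProj σ hσ₄ P
  show ((fun _ : Fin (2 * L - 1 + 1) => combFlat (L := L) (fun k => centralRep (σ k) (blockIm L (wrapBlock L k) k (centralProj L σ σ₄ P))),
      fun _ : Site 3 L => centralRep σ₄ (seamIm L (centralProj L σ σ₄ P))) :
      (Fin (2 * L - 1 + 1) → GaugeConfig 3 L SU2) × (Site 3 L → SU2)) = centralProj L σ σ₄ P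
  simp only [hb, hs]
  rfl

/-- The representatives of `π_C P` lie on the hemispheres of their signs, with radial factor at least `1 − |z_B|²`. [folklore] -/
theorem centralRep_hemisphere {σ : ℝ} (hσ : σ ^ 2 = 1) {z : Fin 3 → ℝ} (hz : (z 0) ^ 2 + (z 1) ^ 2 + (z 2) ^ 2 ≤ 1) :
    0 ≤ σ * (su2Quat (centralRep σ z)).re ∧ 1 - ((z 0) ^ 2 + (z 1) ^ 2 + (z 2) ^ 2) ≤ σ * (su2Quat (centralRep σ z)).re := by
  rw [su2Quat_centralRep hσ hz]
  exact sign_mul_re_liftQuat hσ hz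

/-! ## §2 The central energy scale -/

omit [NeZero L] in
/-- One Lagrange term is at most `4ρ²` when both vectors have `|·|² ≤ ρ`. [folklore] -/
theorem lagrange_term_le {a b : Fin 3 → ℝ} {ρ : ℝ} (ha : a 0 * a 0 + a 1 * a 1 + a 2 * a 2 ≤ ρ) (hb : b 0 * b 0 + b 1 * b 1 + b 2 * b 2 ≤ ρ) :
    4 * ((a 0 * a 0 + a 1 * a 1 + a 2 * a 2) * (b 0 * b 0 + b 1 * b 1 + b 2 * b 2) - (a 0 * b 0 + a 1 * b 1 + a 2 * b 2) ^ 2) ≤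
      4 * ρ ^ 2 := by
  have ha0 : 0 ≤ a 0 * a 0 + a 1 * a 1 + a 2 * a 2 := by nlinarith [sq_nonneg (a 0), sq_nonneg (a 1), sq_nonneg (a 2)]
  have hb0 : 0 ≤ b 0 * b 0 + b 1 * b 1 + b 2 * b 2 := by nlinarith [sq_nonneg (b 0), sq_nonneg (b 1), sq_nonneg (b 2)]
  have h1 : (a 0 * a 0 + a 1 * a 1 + a 2 * a 2) * (b 0 * b 0 + b 1 * b 1 + b 2 * b 2) ≤ ρ * ρ :=
    mul_le_mul ha hb hb0 (ha0.trans ha)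
  nlinarith [sq_nonneg (a 0 * b 0 + a 1 * b 1 + a 2 * b 2)]

/-- ★ **The central energy scale**: if every block average of `P` has `|z_B|² ≤ ρ` then `F₀(π_C P) ≤ 36·L²·ρ²`. [cite: CosteEtAl1985] -/
theorem ringDeficit_centralProj_le {σ : Fin 3 → ℝ} {σ₄ : ℝ} (hσ : ∀ k, σ k = 1 ∨ σ k = -1) (hσ₄ : σ₄ = 1 ∨ σ₄ = -1)
    (P : (Fin (2 * L - 1 + 1) → GaugeConfig 3 L SU2) × (Site 3 L → SU2)) {ρ : ℝ}
    (hz : ∀ k, blockIm L (wrapBlock L k) k P 0 * blockIm L (wrapBlock L k) k P 0 + blockIm L (wrapBlock L k) k P 1 * blockIm L (wrapBlock L k) k P 1 +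
      blockIm L (wrapBlock L k) k P 2 * blockIm L (wrapBlock L k) k P 2 ≤ ρ)
    (hz₄ : seamIm L P 0 * seamIm L P 0 + seamIm L P 1 * seamIm L P 1 + seamIm L P 2 * seamIm L P 2 ≤ ρ) :
    ringDeficit L (fun _ => false) (centralProj L σ σ₄ P) ≤ 36 * (L : ℝ) ^ 2 * ρ ^ 2 := by
  rw [ringDeficit_centralProj hσ hσ₄]
  have hcard : (Finset.univ : Finset {p : Fin 3 × Fin 3 // p.1 < p.2}).card = 3 := by decide
  have h1 : ∑ p : {p : Fin 3 × Fin 3 // p.1 < p.2},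
      4 * ((blockIm L (wrapBlock L p.1.1) p.1.1 P 0 * blockIm L (wrapBlock L p.1.1) p.1.1 P 0 +
            blockIm L (wrapBlock L p.1.1) p.1.1 P 1 * blockIm L (wrapBlock L p.1.1) p.1.1 P 1 +
            blockIm L (wrapBlock L p.1.1) p.1.1 P 2 * blockIm L (wrapBlock L p.1.1) p.1.1 P 2) *
          (blockIm L (wrapBlock L p.1.2) p.1.2 P 0 * blockIm L (wrapBlock L p.1.2) p.1.2 P 0 +
            blockIm L (wrapBlock L p.1.2) p.1.2 P 1 * blockIm L (wrapBlock L p.1.2) p.1.2 P 1 +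
            blockIm L (wrapBlock L p.1.2) p.1.2 P 2 * blockIm L (wrapBlock L p.1.2) p.1.2 P 2) -
        (blockIm L (wrapBlock L p.1.1) p.1.1 P 0 * blockIm L (wrapBlock L p.1.2) p.1.2 P 0 +
          blockIm L (wrapBlock L p.1.1) p.1.1 P 1 * blockIm L (wrapBlock L p.1.2) p.1.2 P 1 +
          blockIm L (wrapBlock L p.1.1) p.1.1 P 2 * blockIm L (wrapBlock L p.1.2) p.1.2 P 2) ^ 2) ≤ 3 * (4 * ρ ^ 2) := by
    calc _ ≤ ∑ p : {p : Fin 3 × Fin 3 // p.1 < p.2}, 4 * ρ ^ 2 := Finset.sum_le_sum fun p _ => lagrange_term_le (hz p.1.1) (hz p.1.2)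
      _ = 3 * (4 * ρ ^ 2) := by rw [Finset.sum_const, hcard, nsmul_eq_mul]; norm_num
  have h2 : ∑ k : Fin 3,
      4 * ((blockIm L (wrapBlock L k) k P 0 * blockIm L (wrapBlock L k) k P 0 + blockIm L (wrapBlock L k) k P 1 * blockIm L (wrapBlock L k) k P 1 +
            blockIm L (wrapBlock L k) k P 2 * blockIm L (wrapBlock L k) k P 2) *
          (seamIm L P 0 * seamIm L P 0 + seamIm L P 1 * seamIm L P 1 + seamIm L P 2 * seamIm L P 2) -
        (blockIm L (wrapBlock L k) k P 0 * seamIm L P 0 + blockIm L (wrapBlock L k) k P 1 * seamIm L P 1 +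
          blockIm L (wrapBlock L k) k P 2 * seamIm L P 2) ^ 2) ≤ 3 * (4 * ρ ^ 2) := by
    calc _ ≤ ∑ k : Fin 3, 4 * ρ ^ 2 := Finset.sum_le_sum fun k _ => lagrange_term_le (hz k) hz₄
      _ = 3 * (4 * ρ ^ 2) := by rw [Finset.sum_const, Finset.card_univ, Fintype.card_fin, nsmul_eq_mul]; norm_num
  have hL2 : (0 : ℝ) ≤ (L : ℝ) ^ 2 := by positivity
  nlinarith

/-! ## §3 (E1) at the projected point, for every history of the chart -/

/-- ★★★ **(E1) at `π_C P` for EVERY `P`**: with signs `σ ∈ {±1}⁴` and every block average of `P` of size `|z_B|² ≤ ρ`, the zero-mode direction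
`Y_z = dirOf fixFrame (u_z(π_C P))` satisfies `2(1 − ρ)·F₀(π_C P) ≤ ∂_{Y_z}F₀(π_C P)`. [cite: CosteEtAl1985] -/
theorem cone_euler_centralProj {σ : Fin 3 → ℝ} {σ₄ : ℝ} (hσ : ∀ k, σ k = 1 ∨ σ k = -1) (hσ₄ : σ₄ = 1 ∨ σ₄ = -1)
    (P : (Fin (2 * L - 1 + 1) → GaugeConfig 3 L SU2) × (Site 3 L → SU2)) {ρ : ℝ}
    (hz : ∀ k, (blockIm L (wrapBlock L k) k P 0) ^ 2 + (blockIm L (wrapBlock L k) k P 1) ^ 2 + (blockIm L (wrapBlock L k) k P 2) ^ 2 ≤ ρ)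
    (hz₄ : (seamIm L P 0) ^ 2 + (seamIm L P 1) ^ 2 + (seamIm L P 2) ^ 2 ≤ ρ) :
    2 * (1 - ρ) * ringDeficit L (fun _ => false) (centralProj L σ σ₄ P) ≤
      frameD (dirOf (fixFrame (L := L)) (zeroModeCoord L σ σ₄ (centralProj L σ σ₄ P))) (ringPoly L)
        (ringCoord L (centralProj L σ σ₄ P)) := by
  have hre : ∀ k, 1 - ρ ≤ σ k * (su2Quat (centralRep (σ k) (blockIm L (wrapBlock L k) k P))).re := fun k => by
    have h := (centralRep_hemisphere (sq_eq_one_of_sign (hσ k)) (normSq_blockIm_le_one (wrapBlock L k) k P)).2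
    linarith [hz k]
  have hre₄ : 1 - ρ ≤ σ₄ * (su2Quat (centralRep σ₄ (seamIm L P))).re := by
    have h := (centralRep_hemisphere (sq_eq_one_of_sign hσ₄) (normSq_seamIm_le_one P)).2
    linarith [hz₄]
  exact cone_euler_fixFrame (fun k => centralRep (σ k) (blockIm L (wrapBlock L k) k P)) (centralRep σ₄ (seamIm L P)) σ σ₄ ρ hre hre₄

end Summit.QuantumFields.YangMills.Theorems.VirialFluxGap.FrameDerivative

end
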